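import Literature.Analysis.FluidPDE.CylindricalCutoff
import Literature.Analysis.FluidPDE.PeriodicDriftPotential
import Literature.Analysis.FluidPDE.SpaceTimeAxisIntegrable
import Literature.Analysis.FluidPDE.KNSSSwirlTransport
import Literature.Analysis.FluidPDE.AxisymWeights
import HarnessLib

/-!
# Lei–Ren–Zhang 2019, Theorem 1.1: the periodic swirl setting at radius `ρ` with apex `τ`

Analysis/FluidPDE proofs file (theorems only, no definitions, no named facts), on the discharge
path of the named fact `Literature.Analysis.FluidPDE.leiRenZhang2019_liouville_periodic`
(Z. Lei, X. Ren, Q. S. Zhang, arXiv:1902.11229 = Math. Ann. 383 (2022), Theorem 1.1). §3, proof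
of Theorem 1.1 (arXiv p. 9): "Consider the domain `P_R = D_R × (−R², 0]` for some `R ≥ 1`" — the
swirl `Γ = r v_θ` of the bounded ancient (mild, hence smooth: KNSS 2009, §4) `z`-periodic
axisymmetric solution solves `∂ₜΓ + b·∇Γ + (2/r)∂ᵣΓ = ΔΓ` ((1.5)) with the smooth divergence-free
periodic drift `b = v_r e_r + v_z e_z`, and §§2–3 work on the cylinders `P_R` with apex shifted
to an arbitrary time.

This is the periodic twin of the tree's `LeiZhang2011.bundle_of_swirl_setting`: from the smooth
swirl setting on `(−∞, 0) × ℝ³` (the output of KNSS 2009, §4 with (5.10), as produced by the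
tree's theorem `KNSS2009_regularity_axisymmetric_swirl_holds`: `Γ(t,·) ∈ C²` axisymmetric,
vanishing on the axis, jointly continuous with `∇Γ`, `ΔΓ`; the drift `U + β e_z` with `U(t)`
smooth, divergence free, bounded; the swirl equation off the axis in time-integrated form) plus
axial `P`-periodicity of `U(t)` and `Γ(t)`, to the "setting at radius `ρ`" consumed by
`LeiRenZhang2019.meanValue_inequality_periodic` and `LeiRenZhang2019.energy_identity_axis_periodic`
after the time shift `s ↦ s + τ`:

* `bundle_of_periodic_swirl_setting_core` — everything except the angular stream potential
  (which `PeriodicDriftPotential` supplies from the exposed representation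
  `b s = U(c s) + β(c s) e_z` of the shifted drift);
* `bundle_of_periodic_swirl_setting` — the full setting, with the angular stream potential
  `Φ(s) = axialDriftPotential (U(c s))` (`∂_zΦ = ⟪b, x_h⟫`, periodic, `|Φ| ≤ C_U P r`).

## References

* Z. Lei, X. Ren, Q. S. Zhang, arXiv:1902.11229, §3, proof of Theorem 1.1 (arXiv p. 9), with (1.5)
  and §2 (the domains `P_R`). [LeiRenZhang2019]
* G. Koch, N. Nadirashvili, G. Seregin, V. Šverák, Acta Math. 203 (2009), §4 and (5.10).
  [KochNadirashviliSereginSverak2009]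
* Z. Lei, Q. S. Zhang, arXiv:1011.5066, proof of Thm. 1.2, step 1 (tree
  `LeiZhang2011.bundle_of_swirl_setting`). [LeiZhang2011]
-/

noncomputable section

open MeasureTheory Set Function Filter Metric intervalIntegral InnerProductSpace
open _root_.Topology
open scoped InnerProductSpace RealInnerProductSpace NNReal ENNReal Laplacian ContDiff

namespace Literature.Analysis.FluidPDE

namespace LeiRenZhang2019

open LeiZhang2011

/-- The closed two-period box `[0, L] × {r ≤ ρ}` is compact. [folklore] -/
private theorem isCompact_box_pss (L ρ : ℝ) :
    IsCompact {x : EuclideanSpace ℝ (Fin 3) | x 2 ∈ Icc 0 L ∧ cylRadius x ≤ ρ} := by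
  have hx2 : Continuous fun x : EuclideanSpace ℝ (Fin 3) => x 2 :=
    (EuclideanSpace.proj (𝕜 := ℝ) (2 : Fin 3)).continuous
  refine Metric.isCompact_of_isClosed_isBounded ?_ ?_
  · exact (isClosed_Icc.preimage hx2).inter (isClosed_le continuous_cylRadius continuous_const)
  · refine (Metric.isBounded_closedBall (x := (0 : EuclideanSpace ℝ (Fin 3))) (r := ρ + |L|)).subset
      fun x hx => ?_
    rw [mem_closedBall_zero_iff]
    have h := norm_le_cylRadius_add_abs_apply_two x
    have h2 : |x 2| ≤ |L| := by
      rw [abs_le]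
      exact ⟨by linarith [hx.1.1, abs_nonneg L], hx.1.2.trans (le_abs_self L)⟩
    linarith [hx.2]

/-- The divergence does not see an additive constant. [folklore] -/
private theorem divergence_add_const_pss (U : EuclideanSpace ℝ (Fin 3) → EuclideanSpace ℝ (Fin 3))
    (c : EuclideanSpace ℝ (Fin 3)) (x : EuclideanSpace ℝ (Fin 3)) :
    VectorCalculus.divergence (fun y => U y + c) x = VectorCalculus.divergence U x := by
  simp only [VectorCalculus.divergence, fderiv_add_const]

set_option maxHeartbeats 1600000 in
-- one long bookkeeping proof (time shift and clamp, the integrated equation off the axis,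
-- joint continuity/measurability, integrability against `1 + 1/r` on the two-period box)
/-- **The periodic setting at radius `ρ` with apex `τ < 0` (core).** Let `Γ = f`, `U`, `β` be
the smooth periodic swirl setting on `(−∞,0) × ℝ³` (`f(t,·) ∈ C²` axisymmetric, vanishing on the
axis, axially `P`-periodic, with `f`, `Df`, `Δf` jointly continuous on `(−∞,0) × ℝ³`; `U(t)`
smooth, divergence free, axially `P`-periodic, jointly measurable, `‖U‖ ≤ C_U`; `β` measurable
and bounded; the swirl equation (KNSS (5.10)) off the axis in time-integrated form with the drift
`U + β e_z`). Then for every `τ < 0` and `ρ > 0` the shifted `F(s,x) = f(s + τ, x)` (`s ≤ 0`,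
clamped for `s > 0`) with `N = ΔF − DF[b] − (2/r)∂ᵣF`, `b(s) = U(c(s)) + β(c(s))e_z`,
`c(s) = τ + min(s,0)`, satisfies: `F(s,·) ∈ C²` axisymmetric periodic vanishing on the axis,
`b(s,·) ∈ C¹` divergence free periodic with `‖b‖ ≤ C_U + C_β`, the integrated equation on
`[−ρ², 0]` for a.e. `x`, `F`, `∇F` jointly continuous, `N` jointly measurable and integrable on
`(−ρ², 0] × ([0, 2P] × {r ≤ ρ})`. [cite: LeiRenZhang2019, §3, proof of Theorem 1.1 (the periodic cylinders P_R for the swirl equation (1.5)), arXiv p. 9; KochNadirashviliSereginSverak2009, (5.10)] -/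
theorem bundle_of_periodic_swirl_setting_core
    {f : ℝ → EuclideanSpace ℝ (Fin 3) → ℝ} {U : ℝ → EuclideanSpace ℝ (Fin 3) → EuclideanSpace ℝ (Fin 3)}
    {β : ℝ → ℝ} {P : ℝ}
    (h1 : ∀ t < 0, ContDiff ℝ 2 (f t))
    (hfc : ContinuousOn (fun p : ℝ × EuclideanSpace ℝ (Fin 3) => f p.1 p.2) (Iio 0 ×ˢ univ))
    (h2 : ContinuousOn (fun p : ℝ × EuclideanSpace ℝ (Fin 3) => fderiv ℝ (f p.1) p.2) (Iio 0 ×ˢ univ))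
    (h3 : ContinuousOn (fun p : ℝ × EuclideanSpace ℝ (Fin 3) => (Δ (f p.1)) p.2) (Iio 0 ×ˢ univ))
    (h4 : ∀ t < 0, IsAxisymmetricScalar (f t))
    (h5 : ∀ t < 0, ∀ x, cylRadius x = 0 → f t x = 0)
    (h6 : ∀ t < 0, IsAxiallyPeriodic P (f t))
    (hU1 : ∀ t < 0, ContDiff ℝ 1 (U t)) (hUdiv : ∀ t < 0, VectorCalculus.IsDivFree (U t))
    (hUper : ∀ t < 0, IsAxiallyPeriodic P (U t))
    (hUm : Measurable (uncurry U)) (hβm : Measurable β)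
    {CU : ℝ} (hUb : ∀ t < 0, ∀ x, ‖U t x‖ ≤ CU) {Cβ : ℝ} (hβb : ∀ t, |β t| ≤ Cβ)
    (h11 : ∀ x, cylRadius x ≠ 0 → ∀ s t : ℝ, s ≤ t → t < 0 →
      f t x - f s x = ∫ τ in s..t, ((Δ (f τ)) x - fderiv ℝ (f τ) x (U τ x + β τ • eZ) -
        2 / cylRadius x * partialDeriv (eR x) (f τ) x))
    (hP : 0 < P) {τ : ℝ} (hτ : τ < 0) {ρ : ℝ} (hρ : 0 < ρ) :
    ∃ (F N : ℝ → EuclideanSpace ℝ (Fin 3) → ℝ)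
      (b : ℝ → EuclideanSpace ℝ (Fin 3) → EuclideanSpace ℝ (Fin 3)) (c : ℝ → ℝ),
      (∀ s, c s < 0) ∧ (∀ s ≤ 0, c s = s + τ) ∧
      (∀ s, F s = f (c s)) ∧ (∀ s x, b s x = U (c s) x + β (c s) • eZ) ∧
      (∀ s, ContDiff ℝ 2 (F s)) ∧ (∀ s, IsAxisymmetricScalar (F s)) ∧
      (∀ s x, cylRadius x = 0 → F s x = 0) ∧ (∀ s, IsAxiallyPeriodic P (F s)) ∧
      (∀ s, ContDiff ℝ 1 (b s)) ∧ (∀ s x, VectorCalculus.divergence (b s) x = 0) ∧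
      (∀ s, IsAxiallyPeriodic P (b s)) ∧ (∀ s x, ‖b s x‖ ≤ CU + Cβ) ∧
      (∀ s x, N s x =
        (Δ (F s)) x - fderiv ℝ (F s) x (b s x) - 2 / cylRadius x * fderiv ℝ (F s) x (eR x)) ∧
      (∀ᵐ x ∂(volume : Measure (EuclideanSpace ℝ (Fin 3))),
        IntervalIntegrable (fun s => N s x) volume (-ρ ^ 2) 0 ∧
          ∀ s ∈ Icc (-ρ ^ 2) 0, F s x = F (-ρ ^ 2) x + ∫ σ in (-ρ ^ 2)..s, N σ x) ∧
      (Continuous fun p : ℝ × EuclideanSpace ℝ (Fin 3) => F p.1 p.2) ∧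
      (Continuous fun p : ℝ × EuclideanSpace ℝ (Fin 3) => gradient (F p.1) p.2) ∧
      AEStronglyMeasurable (fun p : ℝ × EuclideanSpace ℝ (Fin 3) => N p.1 p.2)
        ((volume.restrict (Ioc (-ρ ^ 2) 0)).prod volume) ∧
      Integrable (fun p : ℝ × EuclideanSpace ℝ (Fin 3) => N p.1 p.2)
        ((volume.restrict (Ioc (-ρ ^ 2) 0)).prod
          (volume.restrict {x : EuclideanSpace ℝ (Fin 3) | x 2 ∈ Icc 0 (2 * P) ∧ cylRadius x ≤ ρ})) := by
  -- the clamped time shift `c(s) = τ + min(s, 0) < 0`, `c(s) = s + τ` for `s ≤ 0`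
  obtain ⟨c, hcdef⟩ : ∃ c : ℝ → ℝ, ∀ s, c s = τ + min s 0 := ⟨_, fun _ => rfl⟩
  have hcc : Continuous c := by
    have e : c = fun s => τ + min s 0 := funext hcdef
    rw [e]; exact continuous_const.add (continuous_id.min continuous_const)
  have hcneg : ∀ s, c s < 0 := fun s => by
    have : min s 0 ≤ 0 := min_le_right _ _
    rw [hcdef]; linarith
  have hcle : ∀ s ≤ 0, c s = s + τ := fun s hs => by rw [hcdef, min_eq_left hs]; ring
  set S : Set (ℝ × EuclideanSpace ℝ (Fin 3)) := Iio 0 ×ˢ univ with hS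
  have hcS : ∀ p : ℝ × EuclideanSpace ℝ (Fin 3), (c p.1, p.2) ∈ S := fun p => ⟨hcneg p.1, mem_univ _⟩
  have hcpc : Continuous fun p : ℝ × EuclideanSpace ℝ (Fin 3) => ((c p.1, p.2) : ℝ × EuclideanSpace ℝ (Fin 3)) :=
    (hcc.comp continuous_fst).prodMk continuous_snd
  -- the objects
  obtain ⟨F, hFdef⟩ : ∃ F : ℝ → EuclideanSpace ℝ (Fin 3) → ℝ, ∀ s, F s = f (c s) := ⟨_, fun _ => rfl⟩
  obtain ⟨b, hbdef⟩ : ∃ b : ℝ → EuclideanSpace ℝ (Fin 3) → EuclideanSpace ℝ (Fin 3),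
      ∀ s x, b s x = U (c s) x + β (c s) • eZ := ⟨fun s x => U (c s) x + β (c s) • eZ, fun _ _ => rfl⟩
  obtain ⟨N, hNdef⟩ : ∃ N : ℝ → EuclideanSpace ℝ (Fin 3) → ℝ, ∀ s x, N s x =
      (Δ (F s)) x - fderiv ℝ (F s) x (b s x) - 2 / cylRadius x * fderiv ℝ (F s) x (eR x) := ⟨_, fun _ _ => rfl⟩
  have hCU0 : 0 ≤ CU := (norm_nonneg _).trans (hUb τ hτ 0)
  have hCβ0 : 0 ≤ Cβ := (abs_nonneg _).trans (hβb 0)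
  have hnormeZ : ‖(eZ : EuclideanSpace ℝ (Fin 3))‖ = 1 := by
    have h : (eZ : EuclideanSpace ℝ (Fin 3)) = PiLp.single 2 (2 : Fin 3) (1 : ℝ) := rfl
    rw [h, PiLp.norm_single, norm_one]
  have hbB : ∀ s x, ‖b s x‖ ≤ CU + Cβ := fun s x => by
    rw [hbdef]
    calc ‖U (c s) x + β (c s) • eZ‖ ≤ ‖U (c s) x‖ + ‖β (c s) • (eZ : EuclideanSpace ℝ (Fin 3))‖ := norm_add_le _ _
      _ ≤ CU + Cβ := by
          rw [norm_smul, hnormeZ, mul_one, Real.norm_eq_abs]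
          exact add_le_add (hUb _ (hcneg s) x) (hβb _)
  -- joint continuity of `F`, `∇F`, `ΔF`
  have hFc : Continuous fun p : ℝ × EuclideanSpace ℝ (Fin 3) => F p.1 p.2 := by
    have e : (fun p : ℝ × EuclideanSpace ℝ (Fin 3) => F p.1 p.2) = fun p => f (c p.1) p.2 :=
      funext fun p => by rw [hFdef]
    have h := hfc.comp_continuous hcpc hcS
    rw [e]; exact h
  have hDFc : Continuous fun p : ℝ × EuclideanSpace ℝ (Fin 3) => fderiv ℝ (F p.1) p.2 := by
    have e : (fun p : ℝ × EuclideanSpace ℝ (Fin 3) => fderiv ℝ (F p.1) p.2) = fun p => fderiv ℝ (f (c p.1)) p.2 :=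
      funext fun p => by rw [hFdef]
    have h := h2.comp_continuous hcpc hcS
    rw [e]; exact h
  have hΔFc : Continuous fun p : ℝ × EuclideanSpace ℝ (Fin 3) => (Δ (F p.1)) p.2 := by
    have e : (fun p : ℝ × EuclideanSpace ℝ (Fin 3) => (Δ (F p.1)) p.2) = fun p => (Δ (f (c p.1))) p.2 :=
      funext fun p => by rw [hFdef]
    have h := h3.comp_continuous hcpc hcS
    rw [e]; exact h
  have hgradFc : Continuous fun p : ℝ × EuclideanSpace ℝ (Fin 3) => gradient (F p.1) p.2 := by
    have : (fun p : ℝ × EuclideanSpace ℝ (Fin 3) => gradient (F p.1) p.2) =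
        fun p => (InnerProductSpace.toDual ℝ (EuclideanSpace ℝ (Fin 3))).symm (fderiv ℝ (F p.1) p.2) := rfl
    rw [this]
    exact (InnerProductSpace.toDual ℝ (EuclideanSpace ℝ (Fin 3))).symm.continuous.comp hDFc
  -- measurability of the drift and of `N`
  have hbmeas : Measurable fun p : ℝ × EuclideanSpace ℝ (Fin 3) => b p.1 p.2 := by
    have e : (fun p : ℝ × EuclideanSpace ℝ (Fin 3) => b p.1 p.2) =
        fun p => uncurry U (c p.1, p.2) + β (c p.1) • eZ := funext fun p => by rw [hbdef]; rfl
    rw [e]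
    exact (hUm.comp hcpc.measurable).add (((hβm.comp hcc.measurable).comp measurable_fst).smul_const eZ)
  have hNmeas : Measurable fun p : ℝ × EuclideanSpace ℝ (Fin 3) => N p.1 p.2 := by
    have e : (fun p : ℝ × EuclideanSpace ℝ (Fin 3) => N p.1 p.2) = fun p =>
        (Δ (F p.1)) p.2 - ⟪gradient (F p.1) p.2, b p.1 p.2⟫ -
          2 / cylRadius p.2 * ⟪gradient (F p.1) p.2, eR p.2⟫ := by
      funext p
      rw [hNdef, inner_gradient_left, inner_gradient_left]
    rw [e]
    refine (hΔFc.measurable.sub (hgradFc.measurable.inner hbmeas)).sub ?_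
    exact (measurable_const.div (continuous_cylRadius.measurable.comp measurable_snd)).mul
      (hgradFc.measurable.inner (measurable_eR.comp measurable_snd))
  refine ⟨F, N, b, c, hcneg, hcle, hFdef, hbdef,
    fun s => by rw [hFdef]; exact h1 _ (hcneg s), fun s => by rw [hFdef]; exact h4 _ (hcneg s),
    fun s x hx => by rw [hFdef]; exact h5 _ (hcneg s) x hx, fun s => by rw [hFdef]; exact h6 _ (hcneg s),
    ?_, ?_, ?_, hbB, hNdef, ?_, hFc, hgradFc, hNmeas.aestronglyMeasurable, ?_⟩
  · -- `b(s) ∈ C¹`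
    intro s
    have e : b s = fun x => U (c s) x + β (c s) • eZ := funext (hbdef s)
    rw [e]; exact (hU1 _ (hcneg s)).add contDiff_const
  · -- `div b(s) = 0`
    intro s x
    have e : b s = fun x => U (c s) x + β (c s) • eZ := funext (hbdef s)
    rw [e, divergence_add_const_pss]
    exact hUdiv _ (hcneg s) x
  · -- `b(s)` periodic
    intro s x
    rw [hbdef, hbdef]
    have h := hUper _ (hcneg s) x
    rw [h]
  · -- ### the integrated equation, for a.e. `x` (off the axis)
    have hax : ∀ᵐ x ∂(volume : Measure (EuclideanSpace ℝ (Fin 3))), cylRadius x ≠ 0 := by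
      have h0 := volume_axis_eq_zero
      rw [ae_iff]
      refine measure_mono_null (fun x hx => ?_) h0
      simp only [mem_setOf_eq, not_not] at hx ⊢
      obtain ⟨hx0, hx1⟩ := (cylRadius_eq_zero_iff x).1 hx
      simp [hx0, hx1]
    filter_upwards [hax] with x hx
    obtain ⟨g, hg⟩ : ∃ g : ℝ → ℝ, ∀ t, g t = (Δ (f t)) x - fderiv ℝ (f t) x (U t x + β t • eZ) -
        2 / cylRadius x * partialDeriv (eR x) (f t) x := ⟨_, fun _ => rfl⟩
    have hNg : ∀ σ, N σ x = g (c σ) := fun σ => by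
      rw [hNdef, hg, hFdef, hbdef]; rfl
    have hNxm : Measurable fun σ => N σ x := hNmeas.comp (measurable_id.prodMk measurable_const)
    have hK : IsCompact ((Icc (-ρ ^ 2) (0 : ℝ)) ×ˢ ({x} : Set (EuclideanSpace ℝ (Fin 3)))) :=
      isCompact_Icc.prod isCompact_singleton
    obtain ⟨A₁, hA₁⟩ := hK.exists_bound_of_continuousOn hΔFc.continuousOn
    obtain ⟨A₂, hA₂⟩ := hK.exists_bound_of_continuousOn hDFc.continuousOn
    have hR0 : -ρ ^ 2 ≤ (0 : ℝ) := by nlinarith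
    have hA₂0 : 0 ≤ A₂ := (norm_nonneg _).trans (hA₂ (0, x) ⟨⟨hR0, le_rfl⟩, rfl⟩)
    have hNbd : ∀ σ ∈ Icc (-ρ ^ 2) (0 : ℝ), ‖N σ x‖ ≤ A₁ + A₂ * (CU + Cβ) + 2 / cylRadius x * A₂ := by
      intro σ hσ
      have hp : ((σ, x) : ℝ × EuclideanSpace ℝ (Fin 3)) ∈ Icc (-ρ ^ 2) (0 : ℝ) ×ˢ ({x} : Set _) := ⟨hσ, rfl⟩
      have e1 := hA₁ (σ, x) hp
      have e2 := hA₂ (σ, x) hp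
      have hr0 : 0 ≤ 2 / cylRadius x := div_nonneg zero_le_two (cylRadius_nonneg x)
      rw [Real.norm_eq_abs, hNdef]
      calc |(Δ (F σ)) x - fderiv ℝ (F σ) x (b σ x) - 2 / cylRadius x * fderiv ℝ (F σ) x (eR x)|
          ≤ |(Δ (F σ)) x| + |fderiv ℝ (F σ) x (b σ x)| + |2 / cylRadius x * fderiv ℝ (F σ) x (eR x)| := by
            refine (abs_sub _ _).trans (add_le_add ((abs_sub _ _).trans le_rfl) le_rfl)
        _ ≤ A₁ + A₂ * (CU + Cβ) + 2 / cylRadius x * A₂ := by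
            refine add_le_add (add_le_add ((Real.norm_eq_abs _).symm.le.trans e1) ?_) ?_
            · calc |fderiv ℝ (F σ) x (b σ x)| ≤ ‖fderiv ℝ (F σ) x‖ * ‖b σ x‖ := by
                    rw [← Real.norm_eq_abs]; exact ContinuousLinearMap.le_opNorm _ _
                _ ≤ A₂ * (CU + Cβ) := mul_le_mul e2 (hbB σ x) (norm_nonneg _) hA₂0
            · rw [abs_mul, abs_of_nonneg hr0]
              refine mul_le_mul_of_nonneg_left ?_ hr0
              calc |fderiv ℝ (F σ) x (eR x)| ≤ ‖fderiv ℝ (F σ) x‖ * ‖eR x‖ := by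
                    rw [← Real.norm_eq_abs]; exact ContinuousLinearMap.le_opNorm _ _
                _ ≤ A₂ * 1 := mul_le_mul e2 (norm_eR_le_one x) (norm_nonneg _) hA₂0
                _ = A₂ := mul_one _
    have hNii : IntervalIntegrable (fun σ => N σ x) volume (-ρ ^ 2) 0 := by
      refine (intervalIntegrable_const (c := A₁ + A₂ * (CU + Cβ) + 2 / cylRadius x * A₂)).mono_fun'
        hNxm.aestronglyMeasurable ?_
      rw [uIoc_of_le hR0]
      refine (ae_restrict_iff' measurableSet_Ioc).2 (ae_of_all _ fun σ hσ => ?_)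
      exact hNbd σ (Ioc_subset_Icc_self hσ)
    refine ⟨hNii, fun s hs => ?_⟩
    have hs0 : s ≤ 0 := hs.2
    have hident := h11 x hx (-ρ ^ 2 + τ) (s + τ) (by linarith [hs.1]) (by linarith)
    have eg : (fun t => (Δ (f t)) x - fderiv ℝ (f t) x (U t x + β t • eZ) -
        2 / cylRadius x * partialDeriv (eR x) (f t) x) = g := funext fun t => (hg t).symm
    rw [eg] at hident
    have hshift : ∫ σ in (-ρ ^ 2)..s, N σ x = ∫ t in (-ρ ^ 2 + τ)..(s + τ), g t := by
      rw [← intervalIntegral.integral_comp_add_right g τ]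
      refine intervalIntegral.integral_congr fun σ hσ => ?_
      rw [uIcc_of_le hs.1] at hσ
      show N σ x = g (σ + τ)
      rw [hNg, hcle σ (hσ.2.trans hs0)]
    rw [hshift, ← hident, hFdef, hFdef, hcle s hs0, hcle (-ρ ^ 2) hR0]
    ring
  · -- ### integrability of `N` on `(−ρ², 0] × ([0, 2P] × {r ≤ ρ})` against `1 + 1/r`
    set K : Set (EuclideanSpace ℝ (Fin 3)) := {x | x 2 ∈ Icc 0 (2 * P) ∧ cylRadius x ≤ ρ} with hK
    have hKc : IsCompact K := isCompact_box_pss (2 * P) ρ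
    have hcyl : IsCompact ((Icc (-ρ ^ 2) (0 : ℝ)) ×ˢ K) := isCompact_Icc.prod hKc
    obtain ⟨A₁, hA₁⟩ := hcyl.exists_bound_of_continuousOn hΔFc.continuousOn
    obtain ⟨A₂, hA₂⟩ := hcyl.exists_bound_of_continuousOn hDFc.continuousOn
    have hR0 : -ρ ^ 2 ≤ (0 : ℝ) := by nlinarith
    have h0K : (0 : EuclideanSpace ℝ (Fin 3)) ∈ K := by
      have h02 : (0 : EuclideanSpace ℝ (Fin 3)) 2 = 0 := rfl
      refine ⟨⟨by rw [h02], by rw [h02]; linarith⟩, ?_⟩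
      have : cylRadius (0 : EuclideanSpace ℝ (Fin 3)) = 0 := by simp [cylRadius]
      rw [this]; exact hρ.le
    have hA₁0 : 0 ≤ A₁ := (norm_nonneg _).trans (hA₁ (0, 0) ⟨⟨hR0, le_rfl⟩, h0K⟩)
    have hA₂0 : 0 ≤ A₂ := (norm_nonneg _).trans (hA₂ (0, 0) ⟨⟨hR0, le_rfl⟩, h0K⟩)
    have hCb0 : 0 ≤ CU + Cβ := add_nonneg hCU0 hCβ0
    have hf'i : Integrable ((univ ×ˢ K : Set (ℝ × EuclideanSpace ℝ (Fin 3))).indicator fun p => N p.1 p.2)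
        ((volume.restrict (Ioc (-ρ ^ 2) 0)).prod volume) := by
      refine integrable_prod_of_le_mul_one_add_inv_cylRadius (K := K) hKc ?_ ?_
        (C := A₁ + A₂ * (CU + Cβ) + 2 * A₂) ?_
      · exact (hNmeas.indicator (MeasurableSet.univ.prod hKc.measurableSet)).aestronglyMeasurable
      · intro s x hx
        rw [indicator_of_notMem (show (s, x) ∉ (univ ×ˢ K : Set _) from fun h => hx h.2)]
      · intro s hs x hx
        rw [indicator_of_mem (show (s, x) ∈ (univ ×ˢ K : Set _) from ⟨mem_univ _, hx⟩)]
        have hp : ((s, x) : ℝ × EuclideanSpace ℝ (Fin 3)) ∈ Icc (-ρ ^ 2) (0 : ℝ) ×ˢ K := ⟨Ioc_subset_Icc_self hs, hx⟩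
        have e1 := hA₁ (s, x) hp
        have e2 := hA₂ (s, x) hp
        have hr0 : 0 ≤ (cylRadius x)⁻¹ := inv_nonneg.2 (cylRadius_nonneg x)
        show |N s x| ≤ _
        rw [hNdef]
        calc |(Δ (F s)) x - fderiv ℝ (F s) x (b s x) - 2 / cylRadius x * fderiv ℝ (F s) x (eR x)|
            ≤ |(Δ (F s)) x| + |fderiv ℝ (F s) x (b s x)| + |2 / cylRadius x * fderiv ℝ (F s) x (eR x)| := by
              refine (abs_sub _ _).trans (add_le_add ((abs_sub _ _).trans le_rfl) le_rfl)
          _ ≤ A₁ + A₂ * (CU + Cβ) + 2 * (cylRadius x)⁻¹ * A₂ := by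
              refine add_le_add (add_le_add ((Real.norm_eq_abs _).symm.le.trans e1) ?_) ?_
              · calc |fderiv ℝ (F s) x (b s x)| ≤ ‖fderiv ℝ (F s) x‖ * ‖b s x‖ := by
                      rw [← Real.norm_eq_abs]; exact ContinuousLinearMap.le_opNorm _ _
                  _ ≤ A₂ * (CU + Cβ) := mul_le_mul e2 (hbB s x) (norm_nonneg _) hA₂0
              · rw [abs_mul, div_eq_mul_inv, abs_of_nonneg (by positivity : (0 : ℝ) ≤ 2 * (cylRadius x)⁻¹)]
                refine mul_le_mul_of_nonneg_left ?_ (by positivity)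
                calc |fderiv ℝ (F s) x (eR x)| ≤ ‖fderiv ℝ (F s) x‖ * ‖eR x‖ := by
                      rw [← Real.norm_eq_abs]; exact ContinuousLinearMap.le_opNorm _ _
                  _ ≤ A₂ * 1 := mul_le_mul e2 (norm_eR_le_one x) (norm_nonneg _) hA₂0
                  _ = A₂ := mul_one _
          _ ≤ (A₁ + A₂ * (CU + Cβ) + 2 * A₂) * (1 + (cylRadius x)⁻¹) := by
              nlinarith [mul_nonneg hA₁0 hr0, mul_nonneg (mul_nonneg hA₂0 hCb0) hr0, hA₂0, hr0]
    rw [integrable_indicator_iff (MeasurableSet.univ.prod hKc.measurableSet)] at hf'i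
    have hres : (((volume : Measure ℝ).restrict (Ioc (-ρ ^ 2) 0)).prod
        (volume : Measure (EuclideanSpace ℝ (Fin 3)))).restrict (univ ×ˢ K) =
        (volume.restrict (Ioc (-ρ ^ 2) 0)).prod (volume.restrict K) := by
      rw [← Measure.restrict_univ (μ := volume.restrict (Ioc (-ρ ^ 2) (0 : ℝ))), Measure.prod_restrict,
        Measure.restrict_univ]
    rw [IntegrableOn, hres] at hf'i
    exact hf'i

set_option maxHeartbeats 800000 in
-- the core bundle plus the potential
/-- **The periodic setting at radius `ρ` with apex `τ < 0`** (Lei–Ren–Zhang 2019, proof of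
Theorem 1.1: the swirl equation (1.5) on the periodic cylinders `P_R` with the drift written
through the `z`-periodic angular stream function, (2.5)/(3.4)). As
`bundle_of_periodic_swirl_setting_core`, for `U(t)` smooth with `‖DU‖ ≤ C₁`, axisymmetric:
in addition the angular stream potential `Φ(s) = axialDriftPotential (U(c s))` is `C¹`, axially
`P`-periodic, with `DΦ(s)(x)[e_z] = ⟪b(s,x), x_h⟫` and `|Φ(s,x)| ≤ C_U P r` — exactly the
hypotheses of `LeiRenZhang2019.meanValue_inequality_periodic` and
`LeiRenZhang2019.energy_identity_axis_periodic`. [cite: LeiRenZhang2019, §3, proof of Theorem 1.1 (arXiv p. 9) with §2 (2.5) and §3 (3.4) (the angular stream function); KochNadirashviliSereginSverak2009, (5.10)] -/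
theorem bundle_of_periodic_swirl_setting
    {f : ℝ → EuclideanSpace ℝ (Fin 3) → ℝ} {U : ℝ → EuclideanSpace ℝ (Fin 3) → EuclideanSpace ℝ (Fin 3)}
    {β : ℝ → ℝ} {P : ℝ}
    (h1 : ∀ t < 0, ContDiff ℝ 2 (f t))
    (hfc : ContinuousOn (fun p : ℝ × EuclideanSpace ℝ (Fin 3) => f p.1 p.2) (Iio 0 ×ˢ univ))
    (h2 : ContinuousOn (fun p : ℝ × EuclideanSpace ℝ (Fin 3) => fderiv ℝ (f p.1) p.2) (Iio 0 ×ˢ univ))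
    (h3 : ContinuousOn (fun p : ℝ × EuclideanSpace ℝ (Fin 3) => (Δ (f p.1)) p.2) (Iio 0 ×ˢ univ))
    (h4 : ∀ t < 0, IsAxisymmetricScalar (f t))
    (h5 : ∀ t < 0, ∀ x, cylRadius x = 0 → f t x = 0)
    (h6 : ∀ t < 0, IsAxiallyPeriodic P (f t))
    (hU : ∀ t < 0, ContDiff ℝ ∞ (U t)) (hUdiv : ∀ t < 0, VectorCalculus.IsDivFree (U t))
    (hUax : ∀ t < 0, IsAxisymmetric (U t)) (hUper : ∀ t < 0, IsAxiallyPeriodic P (U t))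
    (hUm : Measurable (uncurry U)) (hβm : Measurable β)
    {CU : ℝ} (hUb : ∀ t < 0, ∀ x, ‖U t x‖ ≤ CU) {C₁ : ℝ} (hDU : ∀ t < 0, ∀ x, ‖fderiv ℝ (U t) x‖ ≤ C₁)
    {Cβ : ℝ} (hβb : ∀ t, |β t| ≤ Cβ)
    (h11 : ∀ x, cylRadius x ≠ 0 → ∀ s t : ℝ, s ≤ t → t < 0 →
      f t x - f s x = ∫ τ in s..t, ((Δ (f τ)) x - fderiv ℝ (f τ) x (U τ x + β τ • eZ) -
        2 / cylRadius x * partialDeriv (eR x) (f τ) x))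
    (hP : 0 < P) {τ : ℝ} (hτ : τ < 0) {ρ : ℝ} (hρ : 0 < ρ) :
    ∃ (F N : ℝ → EuclideanSpace ℝ (Fin 3) → ℝ)
      (b : ℝ → EuclideanSpace ℝ (Fin 3) → EuclideanSpace ℝ (Fin 3))
      (Φ : ℝ → EuclideanSpace ℝ (Fin 3) → ℝ),
      (∀ s ≤ 0, ∀ x, F s x = f (s + τ) x) ∧
      (∀ s, ContDiff ℝ 2 (F s)) ∧ (∀ s, IsAxisymmetricScalar (F s)) ∧
      (∀ s x, cylRadius x = 0 → F s x = 0) ∧ (∀ s, IsAxiallyPeriodic P (F s)) ∧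
      (∀ s, ContDiff ℝ 1 (b s)) ∧ (∀ s x, VectorCalculus.divergence (b s) x = 0) ∧
      (∀ s, IsAxiallyPeriodic P (b s)) ∧ (∀ s x, ‖b s x‖ ≤ CU + Cβ) ∧
      (∀ s, ContDiff ℝ 1 (Φ s)) ∧ (∀ s, IsAxiallyPeriodic P (Φ s)) ∧
      (∀ s x, fderiv ℝ (Φ s) x eZ = ⟪b s x, horizPart x⟫) ∧
      0 ≤ CU * P ∧ (∀ s x, |Φ s x| ≤ CU * P * cylRadius x) ∧
      (∀ s x, N s x =
        (Δ (F s)) x - fderiv ℝ (F s) x (b s x) - 2 / cylRadius x * fderiv ℝ (F s) x (eR x)) ∧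
      (∀ᵐ x ∂(volume : Measure (EuclideanSpace ℝ (Fin 3))),
        IntervalIntegrable (fun s => N s x) volume (-ρ ^ 2) 0 ∧
          ∀ s ∈ Icc (-ρ ^ 2) 0, F s x = F (-ρ ^ 2) x + ∫ σ in (-ρ ^ 2)..s, N σ x) ∧
      (Continuous fun p : ℝ × EuclideanSpace ℝ (Fin 3) => F p.1 p.2) ∧
      (Continuous fun p : ℝ × EuclideanSpace ℝ (Fin 3) => gradient (F p.1) p.2) ∧
      AEStronglyMeasurable (fun p : ℝ × EuclideanSpace ℝ (Fin 3) => N p.1 p.2)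
        ((volume.restrict (Ioc (-ρ ^ 2) 0)).prod volume) ∧
      Integrable (fun p : ℝ × EuclideanSpace ℝ (Fin 3) => N p.1 p.2)
        ((volume.restrict (Ioc (-ρ ^ 2) 0)).prod
          (volume.restrict {x : EuclideanSpace ℝ (Fin 3) | x 2 ∈ Icc 0 (2 * P) ∧ cylRadius x ≤ ρ})) := by
  have hU1 : ∀ t < 0, ContDiff ℝ 1 (U t) := fun t ht => (hU t ht).of_le (by simp)
  obtain ⟨F, N, b, c, hcneg, hcle, hFdef, hbdef, hF2, hFa, hF0, hFp, hb1, hbdiv, hbp, hbB, hN, heq,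
    hFc, hF1c, hNm, hNi⟩ :=
    bundle_of_periodic_swirl_setting_core h1 hfc h2 h3 h4 h5 h6 hU1 hUdiv hUper hUm hβm hUb hβb h11 hP hτ hρ
  have hCU0 : 0 ≤ CU := (norm_nonneg _).trans (hUb τ hτ 0)
  -- the potential
  obtain ⟨Φ, hΦdef⟩ : ∃ Φ : ℝ → EuclideanSpace ℝ (Fin 3) → ℝ, ∀ s, Φ s = axialDriftPotential (U (c s)) :=
    ⟨_, fun _ => rfl⟩
  have hΦp : ∀ s, IsAxiallyPeriodic P (Φ s) := fun s => by
    rw [hΦdef]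
    exact isAxiallyPeriodic_axialDriftPotential (hU1 _ (hcneg s)) (hDU _ (hcneg s)) (hUdiv _ (hcneg s))
      (hUax _ (hcneg s)) (hUper _ (hcneg s))
  refine ⟨F, N, b, Φ, fun s hs x => by rw [hFdef, hcle s hs], hF2, hFa, hF0, hFp, hb1, hbdiv, hbp, hbB,
    ?_, hΦp, ?_, by positivity, ?_, hN, heq, hFc, hF1c, hNm, hNi⟩
  · intro s
    rw [hΦdef]
    exact (contDiff_axialDriftPotential (hU _ (hcneg s))).of_le (by simp)
  · intro s x
    have h0 : ⟪(eZ : EuclideanSpace ℝ (Fin 3)), horizPart x⟫ = 0 := by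
      rw [real_inner_comm]; exact inner_horizPart_eZ x
    rw [hΦdef, fderiv_axialDriftPotential_eZ (hU _ (hcneg s)), hbdef, inner_add_left,
      real_inner_smul_left, h0, mul_zero, add_zero]
  · intro s x
    have hp : IsAxiallyPeriodic P (axialDriftPotential (U (c s))) := by rw [← hΦdef]; exact hΦp s
    rw [hΦdef]
    exact abs_axialDriftPotential_le_mul_cylRadius hP (hUb _ (hcneg s)) hp x

end LeiRenZhang2019

end Literature.Analysis.FluidPDE

end
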